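import Summits.CriticalPhenomena.PercolationContinuityZ3.Theorems.PercNearOneGluingNoHeavyLowerTailKnQuestion8CoefficientwiseCoreClassKernelMixBundleThreeThread
import Summits.CriticalPhenomena.PercolationContinuityZ3.Theorems.PercNearOneGluingNoHeavyLowerTailKnQuestion8CoefficientwiseCoreClassKernelMixIETLayerCake
import HarnessLib

/-!
# ★ CONJECTURE IET on every three-thread bundle Θ(ℓ₀, ℓ₁, ℓ₂): all monotone real levels, every up-closed event

Support file (`--supports stmt-CriticalPhenomena-4575`, closed), prover `prim-cplus-coupling` (gen 59).  No definitions, no notations, no named facts,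
no sorries; standard axioms.  Memo `prim-cplus-coupling/A5-COUPLING-gen59.md` §2 (THEOREM IET(3)).

THEOREM `Coefficientwise.iet_bundle_threeThreads`: on an explicit bundle with hubs `u, b` whose threads are exactly `t₀, t₁, t₂` (pairwise distinct, of
ARBITRARY lengths ≥ 1), the IET functional `Σ_{𝒱, b∈X∖Y} h(X)k(X) + Σ_{𝒱, b∈Y∖X} (hᵃX − hᵇY)(kᵃX − kᵇY)` is nonnegative for EVERY up-closed event `𝒱` and
ALL monotone levels `0 ≤ hᵃ, hᵇ ≤ h`, `0 ≤ kᵃ, kᵇ ≤ k`.  This is the lane's CONJECTURE IET (Kozma–Nitzan-type inequality) for all bundles with three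
threads — the first case with three LONG threads (Θ(3,3,3), Θ(ℓ,ℓ′,ℓ″), …) beyond COROLLARY B (`iet_bundle_shortThreads`, at most two threads of length ≥ 3).
PROOF: layer cake (`iet_of_indicator_levels`, `iet01_ge_count`) + the 0/1 count `bundle_three_thread_count` (THEOREM CT-COUNT + FILL LEMMA + TWO-FREEZE).
[cite: KozmaNitzan2024, Questions 8–9 (§5.5 p. 36) (context); Harris 1960]
-/

namespace Summit.CriticalPhenomena.PercolationContinuityZ3.Theorems

open Finset Literature.Probability.Percolation

namespace Coefficientwise

variable {ι V : Type*}

open Classical in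
/-- **THEOREM IET(3): CONJECTURE IET on every three-thread bundle, all monotone real levels, every up-closed event.**  Module docstring.
Memo gen 59 §2.  [cite: KozmaNitzan2024, Questions 8–9 (§5.5 p. 36) (context); Harris 1960] -/
theorem iet_bundle_threeThreads (ends : ι → Sym2 V) (r : ℕ) (L : ℕ → ℕ) (hL : ∀ t, t < r → 1 ≤ L t)
    (w : ℕ → ℕ → V) (e : ℕ → ℕ → ι) (u b : V)
    (hw0 : ∀ t, t < r → w t 0 = u) (hwL : ∀ t, t < r → w t (L t) = b)
    (harc : ∀ t, t < r → ∀ j, 1 ≤ j → j ≤ L t → ends (e t j) = s(w t (j - 1), w t j))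
    (hwinj : ∀ t, t < r → ∀ i j, i ≤ L t → j ≤ L t → w t i = w t j → i = j)
    (hcross : ∀ t t', t < r → t' < r → t ≠ t' → ∀ i j, i ≤ L t → j ≤ L t' → w t i = w t' j → (i = 0 ∧ j = 0) ∨ (i = L t ∧ j = L t'))
    (A : ℕ → Finset ι) (hA : ∀ t, t < r → ∀ i, i ∈ A t ↔ ∃ j, 1 ≤ j ∧ j ≤ L t ∧ e t j = i)
    (hAdisj : ∀ t t', t < r → t' < r → t ≠ t' → Disjoint (A t) (A t'))
    (E : Finset ι) (hEA : ∀ i, i ∈ E ↔ ∃ t, t < r ∧ i ∈ A t)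
    (t₀ t₁ t₂ : ℕ) (ht₀ : t₀ < r) (ht₁ : t₁ < r) (ht₂ : t₂ < r) (h01 : t₀ ≠ t₁) (h02 : t₀ ≠ t₂) (h12 : t₁ ≠ t₂)
    (hr3 : ∀ t, t < r → t = t₀ ∨ t = t₁ ∨ t = t₂)
    (𝒱 : Finset ι → Prop) (hV : ∀ ⦃s t : Finset ι⦄, s ⊆ t → 𝒱 s → 𝒱 t)
    (h k ha hb ka kb : Set V → ℝ) (mh : Monotone h) (mk : Monotone k)
    (mha : Monotone ha) (mhb : Monotone hb) (mka : Monotone ka) (mkb : Monotone kb)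
    (ha0 : ∀ S, 0 ≤ ha S) (hah : ∀ S, ha S ≤ h S) (hb0 : ∀ S, 0 ≤ hb S) (hbh : ∀ S, hb S ≤ h S)
    (ka0 : ∀ S, 0 ≤ ka S) (kak : ∀ S, ka S ≤ k S) (kb0 : ∀ S, 0 ≤ kb S) (kbk : ∀ S, kb S ≤ k S) :
    0 ≤ (∑ ω ∈ E.powerset, if 𝒱 ω ∧ (b ∈ openCluster (ends '' (↑ω : Set ι)) u ∧ b ∉ openCluster (ends '' (↑(E \ ω) : Set ι)) u) then
        h (openCluster (ends '' (↑ω : Set ι)) u) * k (openCluster (ends '' (↑ω : Set ι)) u) else 0)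
      + ∑ ω ∈ E.powerset, if 𝒱 ω ∧ (b ∈ openCluster (ends '' (↑(E \ ω) : Set ι)) u ∧ b ∉ openCluster (ends '' (↑ω : Set ι)) u) then
        (ha (openCluster (ends '' (↑ω : Set ι)) u) - hb (openCluster (ends '' (↑(E \ ω) : Set ι)) u)) *
          (ka (openCluster (ends '' (↑ω : Set ι)) u) - kb (openCluster (ends '' (↑(E \ ω) : Set ι)) u)) else 0 := by
  set C : Finset ι → Set V := fun ω => openCluster (ends '' (↑ω : Set ι)) u with hC
  refine iet_of_indicator_levels E (fun ω => 𝒱 ω ∧ (b ∈ C ω ∧ b ∉ C (E \ ω)))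
    (fun ω => 𝒱 ω ∧ (b ∈ C (E \ ω) ∧ b ∉ C ω)) C (fun ω => C (E \ ω)) ?_
    h k ha hb ka kb mh mk mha mhb mka mkb ha0 hah hb0 hbh ka0 kak kb0 kbk
  intro h k ha hb ka kb mh mk mha mhb mka mkb h01' k01 ha01 hb01 ka01 kb01 hah hbh kak kbk
  have cnt := iet01_ge_count E (fun ω => 𝒱 ω ∧ (b ∈ C ω ∧ b ∉ C (E \ ω)))
    (fun ω => 𝒱 ω ∧ (b ∈ C (E \ ω) ∧ b ∉ C ω)) C (fun ω => C (E \ ω)) h k ha hb ka kb h01' k01 ha01 hb01 ka01 kb01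
  have ct := bundle_three_thread_count ends r L hL w e u b hw0 hwL harc hwinj hcross A hA hAdisj E hEA t₀ t₁ t₂ ht₀ ht₁ ht₂ h01 h02 h12 hr3 𝒱 hV
    h k ha hb ka kb mha mhb mka mkb h01' k01 ha01 hb01 ka01 kb01 hah hbh kak kbk
  -- the four 0/1 sums are the four counts
  have d1 : (∑ ω ∈ E.powerset, if (𝒱 ω ∧ (b ∈ C (E \ ω) ∧ b ∉ C ω)) ∧
        ha (C ω) = 1 ∧ kb (C (E \ ω)) = 1 ∧ hb (C (E \ ω)) = 0 ∧ ka (C ω) = 0 then (1 : ℝ) else 0) =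
      (((E.powerset).filter (fun σ => 𝒱 σ ∧ (b ∈ C (E \ σ) ∧ b ∉ C σ) ∧
        (ha (C σ) = 1 ∧ hb (C (E \ σ)) = 0) ∧ (kb (C (E \ σ)) = 1 ∧ ka (C σ) = 0))).card : ℝ) := by
    rw [Finset.natCast_card_filter]
    refine Finset.sum_congr rfl fun ω _ => ?_
    by_cases hP : (𝒱 ω ∧ (b ∈ C (E \ ω) ∧ b ∉ C ω)) ∧ ha (C ω) = 1 ∧ kb (C (E \ ω)) = 1 ∧ hb (C (E \ ω)) = 0 ∧ ka (C ω) = 0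
    · rw [if_pos hP, if_pos ⟨hP.1.1, hP.1.2, ⟨hP.2.1, hP.2.2.2.1⟩, ⟨hP.2.2.1, hP.2.2.2.2⟩⟩]
    · rw [if_neg hP, if_neg (fun hQ => hP ⟨⟨hQ.1, hQ.2.1⟩, hQ.2.2.1.1, hQ.2.2.2.1, hQ.2.2.1.2, hQ.2.2.2.2⟩)]
  have d2 : (∑ ω ∈ E.powerset, if (𝒱 ω ∧ (b ∈ C (E \ ω) ∧ b ∉ C ω)) ∧
        hb (C (E \ ω)) = 1 ∧ ka (C ω) = 1 ∧ ha (C ω) = 0 ∧ kb (C (E \ ω)) = 0 then (1 : ℝ) else 0) =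
      (((E.powerset).filter (fun σ => 𝒱 σ ∧ (b ∈ C (E \ σ) ∧ b ∉ C σ) ∧
        (ka (C σ) = 1 ∧ kb (C (E \ σ)) = 0) ∧ (hb (C (E \ σ)) = 1 ∧ ha (C σ) = 0))).card : ℝ) := by
    rw [Finset.natCast_card_filter]
    refine Finset.sum_congr rfl fun ω _ => ?_
    by_cases hP : (𝒱 ω ∧ (b ∈ C (E \ ω) ∧ b ∉ C ω)) ∧ hb (C (E \ ω)) = 1 ∧ ka (C ω) = 1 ∧ ha (C ω) = 0 ∧ kb (C (E \ ω)) = 0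
    · rw [if_pos hP, if_pos ⟨hP.1.1, hP.1.2, ⟨hP.2.2.1, hP.2.2.2.2⟩, ⟨hP.2.1, hP.2.2.2.1⟩⟩]
    · rw [if_neg hP, if_neg (fun hQ => hP ⟨⟨hQ.1, hQ.2.1⟩, hQ.2.2.2.1, hQ.2.2.1.1, hQ.2.2.2.2, hQ.2.2.1.2⟩)]
  have d3 : (∑ ω ∈ E.powerset, if (𝒱 ω ∧ (b ∈ C (E \ ω) ∧ b ∉ C ω)) ∧
        ha (C ω) = 1 ∧ ka (C ω) = 1 ∧ hb (C (E \ ω)) = 0 ∧ kb (C (E \ ω)) = 0 then (1 : ℝ) else 0) =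
      (((E.powerset).filter (fun σ => 𝒱 σ ∧ (b ∈ C (E \ σ) ∧ b ∉ C σ) ∧
        (ha (C σ) = 1 ∧ ka (C σ) = 1 ∧ hb (C (E \ σ)) = 0 ∧ kb (C (E \ σ)) = 0))).card : ℝ) := by
    rw [Finset.natCast_card_filter]
    refine Finset.sum_congr rfl fun ω _ => ?_
    by_cases hP : (𝒱 ω ∧ (b ∈ C (E \ ω) ∧ b ∉ C ω)) ∧ ha (C ω) = 1 ∧ ka (C ω) = 1 ∧ hb (C (E \ ω)) = 0 ∧ kb (C (E \ ω)) = 0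
    · rw [if_pos hP, if_pos ⟨hP.1.1, hP.1.2, hP.2⟩]
    · rw [if_neg hP, if_neg (fun hQ => hP ⟨⟨hQ.1, hQ.2.1⟩, hQ.2.2⟩)]
  have s1 : (∑ ω ∈ E.powerset, if (𝒱 ω ∧ (b ∈ C ω ∧ b ∉ C (E \ ω))) ∧ h (C ω) = 1 ∧ k (C ω) = 1 then (1 : ℝ) else 0) =
      (((E.powerset).filter (fun lam => 𝒱 lam ∧ (b ∈ C lam ∧ b ∉ C (E \ lam)) ∧ h (C lam) = 1 ∧ k (C lam) = 1)).card : ℝ) := by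
    rw [Finset.natCast_card_filter]
    refine Finset.sum_congr rfl fun ω _ => ?_
    by_cases hP : (𝒱 ω ∧ (b ∈ C ω ∧ b ∉ C (E \ ω))) ∧ h (C ω) = 1 ∧ k (C ω) = 1
    · rw [if_pos hP, if_pos ⟨hP.1.1, hP.1.2, hP.2⟩]
    · rw [if_neg hP, if_neg (fun hQ => hP ⟨⟨hQ.1, hQ.2.1⟩, hQ.2.2⟩)]
  have ct' : (((E.powerset).filter (fun σ => 𝒱 σ ∧ (b ∈ C (E \ σ) ∧ b ∉ C σ) ∧
        (ha (C σ) = 1 ∧ hb (C (E \ σ)) = 0) ∧ (kb (C (E \ σ)) = 1 ∧ ka (C σ) = 0))).card : ℝ) +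
      (((E.powerset).filter (fun σ => 𝒱 σ ∧ (b ∈ C (E \ σ) ∧ b ∉ C σ) ∧
        (ka (C σ) = 1 ∧ kb (C (E \ σ)) = 0) ∧ (hb (C (E \ σ)) = 1 ∧ ha (C σ) = 0))).card : ℝ) ≤
      (((E.powerset).filter (fun lam => 𝒱 lam ∧ (b ∈ C lam ∧ b ∉ C (E \ lam)) ∧ h (C lam) = 1 ∧ k (C lam) = 1)).card : ℝ) +
      (((E.powerset).filter (fun σ => 𝒱 σ ∧ (b ∈ C (E \ σ) ∧ b ∉ C σ) ∧
        (ha (C σ) = 1 ∧ ka (C σ) = 1 ∧ hb (C (E \ σ)) = 0 ∧ kb (C (E \ σ)) = 0))).card : ℝ) := by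
    have hnat := (Nat.cast_le (α := ℝ)).mpr ct
    rw [Nat.cast_add, Nat.cast_add] at hnat
    convert hnat using 4
  refine le_trans ?_ cnt
  linarith [d1, d2, d3, s1, ct']

open Classical in
/-- **THEOREM IET(3), lane format `r = 3`.**  The same statement for an explicit bundle with `r = 3` threads indexed `0, 1, 2`.
[cite: KozmaNitzan2024, Questions 8–9 (§5.5 p. 36) (context); Harris 1960] -/
theorem iet_bundle_threeThreads' (ends : ι → Sym2 V) (r : ℕ) (hr : r = 3) (L : ℕ → ℕ) (hL : ∀ t, t < r → 1 ≤ L t)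
    (w : ℕ → ℕ → V) (e : ℕ → ℕ → ι) (u b : V)
    (hw0 : ∀ t, t < r → w t 0 = u) (hwL : ∀ t, t < r → w t (L t) = b)
    (harc : ∀ t, t < r → ∀ j, 1 ≤ j → j ≤ L t → ends (e t j) = s(w t (j - 1), w t j))
    (hwinj : ∀ t, t < r → ∀ i j, i ≤ L t → j ≤ L t → w t i = w t j → i = j)
    (hcross : ∀ t t', t < r → t' < r → t ≠ t' → ∀ i j, i ≤ L t → j ≤ L t' → w t i = w t' j → (i = 0 ∧ j = 0) ∨ (i = L t ∧ j = L t'))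
    (A : ℕ → Finset ι) (hA : ∀ t, t < r → ∀ i, i ∈ A t ↔ ∃ j, 1 ≤ j ∧ j ≤ L t ∧ e t j = i)
    (hAdisj : ∀ t t', t < r → t' < r → t ≠ t' → Disjoint (A t) (A t'))
    (E : Finset ι) (hEA : ∀ i, i ∈ E ↔ ∃ t, t < r ∧ i ∈ A t)
    (𝒱 : Finset ι → Prop) (hV : ∀ ⦃s t : Finset ι⦄, s ⊆ t → 𝒱 s → 𝒱 t)
    (h k ha hb ka kb : Set V → ℝ) (mh : Monotone h) (mk : Monotone k)
    (mha : Monotone ha) (mhb : Monotone hb) (mka : Monotone ka) (mkb : Monotone kb)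
    (ha0 : ∀ S, 0 ≤ ha S) (hah : ∀ S, ha S ≤ h S) (hb0 : ∀ S, 0 ≤ hb S) (hbh : ∀ S, hb S ≤ h S)
    (ka0 : ∀ S, 0 ≤ ka S) (kak : ∀ S, ka S ≤ k S) (kb0 : ∀ S, 0 ≤ kb S) (kbk : ∀ S, kb S ≤ k S) :
    0 ≤ (∑ ω ∈ E.powerset, if 𝒱 ω ∧ (b ∈ openCluster (ends '' (↑ω : Set ι)) u ∧ b ∉ openCluster (ends '' (↑(E \ ω) : Set ι)) u) then
        h (openCluster (ends '' (↑ω : Set ι)) u) * k (openCluster (ends '' (↑ω : Set ι)) u) else 0)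
      + ∑ ω ∈ E.powerset, if 𝒱 ω ∧ (b ∈ openCluster (ends '' (↑(E \ ω) : Set ι)) u ∧ b ∉ openCluster (ends '' (↑ω : Set ι)) u) then
        (ha (openCluster (ends '' (↑ω : Set ι)) u) - hb (openCluster (ends '' (↑(E \ ω) : Set ι)) u)) *
          (ka (openCluster (ends '' (↑ω : Set ι)) u) - kb (openCluster (ends '' (↑(E \ ω) : Set ι)) u)) else 0 :=
  iet_bundle_threeThreads ends r L hL w e u b hw0 hwL harc hwinj hcross A hA hAdisj E hEA 0 1 2 (by omega) (by omega) (by omega)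
    (by omega) (by omega) (by omega) (fun t ht => by omega) 𝒱 hV h k ha hb ka kb mh mk mha mhb mka mkb ha0 hah hb0 hbh ka0 kak kb0 kbk

end Coefficientwise

end Summit.CriticalPhenomena.PercolationContinuityZ3.Theorems
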